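import Summits.ResolutionOfSingularities.ResolutionOfSingularities.Theorems.FrobeniusLadderFInjectiveMacaulayficationRelGddF192Data
import Mathlib.RingTheory.MvPolynomial.WeightedHomogeneous
import Mathlib.Algebra.MvPolynomial.PDeriv
import Mathlib.Algebra.MvPolynomial.Equiv
import Mathlib.Algebra.Polynomial.Degree.Domain
import Mathlib.RingTheory.Polynomial.UniqueFactorization
import Mathlib.RingTheory.Ideal.Quotient.Operations
import HarnessLib

/-!
# ROWC row F021 at `p = 5` — a (D)-CLASS relative instance (cone bad along one orbit, blow-up FULL anyway):
# characteristic-free data of the diagonal form `g = z² + t⁴y²w⁴ + (y² + x³)³ + y⁴w² + x¹¹ + w⁷` and of its `(2,3,9,3 | 0)`-initial form `g₀`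
# (crux `FInjectiveMacaulayfication` stmt-ResolutionOfSingularities-15315, relative filtered engine v2 `FilteredConeFiModelRelDirect`;
# RULING R16.30 (5) of res-L1-w45a-plan-1; third clone of the facet template)

Support file for crux stmt-ResolutionOfSingularities-15315 (`FrobeniusLadder.FInjectiveMacaulayfication`), chain w45a, seat
res-L1-w45a-stub-4 g6. [OURS · L1 W4.5a; specimen = ROWC row F021 (res-L1-w45a-idea-2 `ROWC-r2.md`, (D)-survivors
`2·t⁴y′²z′⁴u³`, `x′³y′⁴z′⁴u³`; HOFF ∅-row per res-L1-w45a-tri-1 j288098); template = `RelGddF211Data` / res-L1-w45a-stub-1's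
`RelGddF008Data`] — NOT a statement of the manuscript [claim: Hironaka2017]; AI-written, weaker than expert review.

**The row.** `F021 = T₁₁ + t²·y·z·w² + y⁴·w²`, `T₁₁ = z² + (y² + x³)³ + x¹¹ + w⁷`, in `k[x,y,z,w,t] = k[X₀,…,X₄]`, `char k = 5`: an integral
fourfold hypersurface singular EXACTLY along the `t`-axis `L = V(x,y,z,w)`, whose `(2,3,9,3 | t ↦ 0)`-weighted tangent cone along `L`
is NOT F-pure along the orbit `O = {x = y = z = t = 0}` — and yet ONE weighted blow-up along `I₁₈` FULL-ifies it (the tail `w⁷`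
supplies the Fedder witness in the `w`-chart).  As for F008 we first apply the GRADED coordinate change `σ : z ↦ z + 2t²yw²` (`z` and
`t²yw²` both weigh `9`; `σ` preserves `I₁₈`): in characteristic `5`, `σ(F021) = g + 5·(t²yw²z + t⁴y²w⁴)`, so
`k[X]/(F021) ≅ k[X]/(g)` with the DIAGONAL form
  `g = X₂² + X₄⁴X₁²X₃⁴ + (X₁² + X₀³)³ + X₁⁴X₃² + X₀¹¹ + X₃⁷`, initial form `g₀ = X₂² + X₄⁴X₁²X₃⁴ + (X₁² + X₀³)³ + X₁⁴X₃²`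
(`w`-weight `18`; the tail `X₀¹¹ + X₃⁷` has weights `22, 21`).  This file supplies the characteristic-free inputs of the engine for
`(g, g₀)`: homogeneity / initial form / order (`g0_isWeightedHomogeneous`, `weightedHomogeneousComponent_eighteen`,
`weightedHomogeneousComponent_lt_eighteen`, `g0_ne_zero`, `g_ne_zero`), primality over EVERY field (`prime_g`: `T² + c`,
`c(0,0,T,0) = T⁷` odd; `span_g_isPrime`, `g_X_ne_zero`), the partial derivatives of `g` and `g₀`, and the graded automorphism
(`RelGddF192Data.exists_sigma`, `sigma_f021_eq`).  `hpow` = `RelGddF008Hpow.hpow_2393_18` (same facet).  No definitions, no named facts. [folklore]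
-/

-- single-problem summit: the doubled namespace component is forced
set_option linter.dupNamespace false

noncomputable section

namespace Summit.ResolutionOfSingularities.ResolutionOfSingularities.Theorems.FInjectiveMacaulayfication.RelGddF021Data

open MvPolynomial
open Summit.ResolutionOfSingularities.ResolutionOfSingularities.Theorems.FInjectiveMacaulayfication

/-! ## Weighted homogeneity and the initial form -/

/-- `g₀ = X₂² + X₄⁴X₁²X₃⁴ + (X₁² + X₀³)³ + X₁⁴X₃²` is `(2,3,9,3,0)`-weighted-homogeneous of weight `18`. [folklore] -/
theorem g0_isWeightedHomogeneous (k : Type) [Field k] :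
    MvPolynomial.IsWeightedHomogeneous (![2, 3, 9, 3, 0] : Fin 5 → ℕ)
      (X 2 ^ 2 + X 4 ^ 4 * X 1 ^ 2 * X 3 ^ 4 + (X 1 ^ 2 + X 0 ^ 3) ^ 3 + X 1 ^ 4 * X 3 ^ 2 : MvPolynomial (Fin 5) k) 18 := by
  have hX := fun j : Fin 5 => isWeightedHomogeneous_X k (![2, 3, 9, 3, 0] : Fin 5 → ℕ) j
  have hφ : IsWeightedHomogeneous (![2, 3, 9, 3, 0] : Fin 5 → ℕ) (X 1 ^ 2 + X 0 ^ 3 : MvPolynomial (Fin 5) k) 6 := by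
    refine IsWeightedHomogeneous.add ?_ ?_
    · simpa using (hX 1).pow 2
    · simpa using (hX 0).pow 3
  refine (((?_ : IsWeightedHomogeneous _ _ 18).add ?_).add ?_).add ?_
  · simpa using (hX 2).pow 2
  · simpa using (((hX 4).pow 4).mul ((hX 1).pow 2)).mul ((hX 3).pow 4)
  · simpa using hφ.pow 3
  · simpa using ((hX 1).pow 4).mul ((hX 3).pow 2)

/-- **The `(2,3,9,3,0)`-weight-`18` component of `g` is `g₀`.** [folklore] -/
theorem weightedHomogeneousComponent_eighteen (k : Type) [Field k] (g : MvPolynomial (Fin 5) k)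
    (hg : g = X 2 ^ 2 + X 4 ^ 4 * X 1 ^ 2 * X 3 ^ 4 + (X 1 ^ 2 + X 0 ^ 3) ^ 3 + X 1 ^ 4 * X 3 ^ 2 + X 0 ^ 11 + X 3 ^ 7) :
    MvPolynomial.weightedHomogeneousComponent (![2, 3, 9, 3, 0] : Fin 5 → ℕ) 18 g =
      X 2 ^ 2 + X 4 ^ 4 * X 1 ^ 2 * X 3 ^ 4 + (X 1 ^ 2 + X 0 ^ 3) ^ 3 + X 1 ^ 4 * X 3 ^ 2 := by
  rw [hg, map_add, map_add, (g0_isWeightedHomogeneous k).weightedHomogeneousComponent_same,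
    (RelGddF008Data.x11_isWeightedHomogeneous k).weightedHomogeneousComponent_ne 18 (by norm_num),
    (RelGddF008Data.w7_isWeightedHomogeneous k).weightedHomogeneousComponent_ne 18 (by norm_num), add_zero, add_zero]

/-- **`g` has `(2,3,9,3,0)`-order `18`**: all weighted-homogeneous components below `18` vanish. [folklore] -/
theorem weightedHomogeneousComponent_lt_eighteen (k : Type) [Field k] (g : MvPolynomial (Fin 5) k)
    (hg : g = X 2 ^ 2 + X 4 ^ 4 * X 1 ^ 2 * X 3 ^ 4 + (X 1 ^ 2 + X 0 ^ 3) ^ 3 + X 1 ^ 4 * X 3 ^ 2 + X 0 ^ 11 + X 3 ^ 7) :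
    ∀ m < 18, MvPolynomial.weightedHomogeneousComponent (![2, 3, 9, 3, 0] : Fin 5 → ℕ) m g = 0 := by
  intro m hm
  rw [hg, map_add, map_add, (g0_isWeightedHomogeneous k).weightedHomogeneousComponent_ne m (by omega),
    (RelGddF008Data.x11_isWeightedHomogeneous k).weightedHomogeneousComponent_ne m (by omega),
    (RelGddF008Data.w7_isWeightedHomogeneous k).weightedHomogeneousComponent_ne m (by omega), add_zero, add_zero]

/-- `g₀ ≠ 0` (it takes the value `1` at `(0,0,1,0,0)`). [folklore] -/
theorem g0_ne_zero (k : Type) [Field k] :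
    (X 2 ^ 2 + X 4 ^ 4 * X 1 ^ 2 * X 3 ^ 4 + (X 1 ^ 2 + X 0 ^ 3) ^ 3 + X 1 ^ 4 * X 3 ^ 2 : MvPolynomial (Fin 5) k) ≠ 0 := by
  intro h0
  have h1 := congrArg (MvPolynomial.eval ![(0 : k), 0, 1, 0, 0]) h0
  simp at h1

/-- `g ≠ 0` (it takes the value `1` at `(0,0,1,0,0)`). [folklore] -/
theorem g_ne_zero (k : Type) [Field k] :
    (X 2 ^ 2 + X 4 ^ 4 * X 1 ^ 2 * X 3 ^ 4 + (X 1 ^ 2 + X 0 ^ 3) ^ 3 + X 1 ^ 4 * X 3 ^ 2 + X 0 ^ 11 + X 3 ^ 7 :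
      MvPolynomial (Fin 5) k) ≠ 0 := by
  intro h0
  have h1 := congrArg (MvPolynomial.eval ![(0 : k), 0, 1, 0, 0]) h0
  simp at h1

/-! ## Primality over every field -/

/-- **`g` is prime over every field and divides no variable** (`k[X₀,…,X₄] ≃ k[Y₀,…,Y₃][T]`, `X₂ ↦ T`, `X₀ ↦ C Y₁`, `X₁ ↦ C Y₀`,
`X₃ ↦ C Y₂`, `X₄ ↦ C Y₃`; `g ↦ T² + c`, `c(0,0,T,0) = T⁷` has odd degree). [folklore] -/
theorem prime_g (k : Type) [Field k] (g : MvPolynomial (Fin 5) k)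
    (hg : g = X 2 ^ 2 + X 4 ^ 4 * X 1 ^ 2 * X 3 ^ 4 + (X 1 ^ 2 + X 0 ^ 3) ^ 3 + X 1 ^ 4 * X 3 ^ 2 + X 0 ^ 11 + X 3 ^ 7) :
    Prime g ∧ ∀ v : Fin 5, ¬ g ∣ MvPolynomial.X v := by
  obtain ⟨e, he0, he1, he2, he3, he4⟩ : ∃ e : MvPolynomial (Fin 5) k ≃+* Polynomial (MvPolynomial (Fin 4) k),
      e (X 0) = Polynomial.C (X 1) ∧ e (X 1) = Polynomial.C (X 0) ∧ e (X 2) = Polynomial.X ∧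
        e (X 3) = Polynomial.C (X 2) ∧ e (X 4) = Polynomial.C (X 3) := by
    refine ⟨((renameEquiv k (Equiv.swap (0 : Fin 5) 2)).trans (finSuccEquiv k 4)).toRingEquiv, ?_, ?_, ?_, ?_, ?_⟩
    · show finSuccEquiv k 4 (rename (Equiv.swap (0 : Fin 5) 2) (X 0)) = _
      rw [rename_X, Equiv.swap_apply_left]
      exact finSuccEquiv_X_succ (j := 1)
    · show finSuccEquiv k 4 (rename (Equiv.swap (0 : Fin 5) 2) (X 1)) = _
      rw [rename_X, Equiv.swap_apply_of_ne_of_ne (by decide) (by decide)]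
      exact finSuccEquiv_X_succ (j := 0)
    · show finSuccEquiv k 4 (rename (Equiv.swap (0 : Fin 5) 2) (X 2)) = _
      rw [rename_X, Equiv.swap_apply_right]
      exact finSuccEquiv_X_zero
    · show finSuccEquiv k 4 (rename (Equiv.swap (0 : Fin 5) 2) (X 3)) = _
      rw [rename_X, Equiv.swap_apply_of_ne_of_ne (by decide) (by decide)]
      exact finSuccEquiv_X_succ (j := 2)
    · show finSuccEquiv k 4 (rename (Equiv.swap (0 : Fin 5) 2) (X 4)) = _
      rw [rename_X, Equiv.swap_apply_of_ne_of_ne (by decide) (by decide)]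
      exact finSuccEquiv_X_succ (j := 3)
  have heg : e g = Polynomial.X ^ 2 +
      Polynomial.C (X 3 ^ 4 * X 0 ^ 2 * X 2 ^ 4 + (X 0 ^ 2 + X 1 ^ 3) ^ 3 + X 0 ^ 4 * X 2 ^ 2 + X 1 ^ 11 + X 2 ^ 7 :
        MvPolynomial (Fin 4) k) := by
    subst hg
    simp only [map_add, map_mul, map_pow, he0, he1, he2, he3, he4]
    ring
  have hc : ∀ a : MvPolynomial (Fin 4) k,
      a * a ≠ -(X 3 ^ 4 * X 0 ^ 2 * X 2 ^ 4 + (X 0 ^ 2 + X 1 ^ 3) ^ 3 + X 0 ^ 4 * X 2 ^ 2 + X 1 ^ 11 + X 2 ^ 7) := by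
    refine HWeightedData.mul_self_ne_neg_of_odd_natDegree ![0, 0, Polynomial.X, 0] ?_
    have hv : MvPolynomial.aeval (![0, 0, Polynomial.X, 0] : Fin 4 → Polynomial k)
        (X 3 ^ 4 * X 0 ^ 2 * X 2 ^ 4 + (X 0 ^ 2 + X 1 ^ 3) ^ 3 + X 0 ^ 4 * X 2 ^ 2 + X 1 ^ 11 + X 2 ^ 7 :
          MvPolynomial (Fin 4) k) = Polynomial.X ^ 7 := by
      simp only [map_add, map_mul, map_pow, MvPolynomial.aeval_X, Matrix.cons_val_zero, Matrix.cons_val_one, Matrix.cons_val]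
      norm_num
    rw [hv, Polynomial.natDegree_X_pow]
    decide
  obtain ⟨hp, hnd⟩ := E8Forms.prime_and_not_dvd_of_ringEquiv e g _ heg hc
  refine ⟨hp, fun v => ?_⟩
  fin_cases v
  · exact hnd (X 0) (X 1) (X_ne_zero 1) he0
  · exact hnd (X 1) (X 0) (X_ne_zero 0) he1
  · rintro ⟨q, hq⟩
    have h1 : (Polynomial.X ^ 2 + Polynomial.C (X 3 ^ 4 * X 0 ^ 2 * X 2 ^ 4 + (X 0 ^ 2 + X 1 ^ 3) ^ 3 + X 0 ^ 4 * X 2 ^ 2 +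
        X 1 ^ 11 + X 2 ^ 7) : Polynomial (MvPolynomial (Fin 4) k)) ∣ Polynomial.X :=
      ⟨e q, by rw [← heg, ← map_mul, ← hq]; exact he2.symm⟩
    have h2 := Polynomial.natDegree_le_of_dvd h1 Polynomial.X_ne_zero
    rw [Polynomial.natDegree_X_pow_add_C, Polynomial.natDegree_X] at h2
    omega
  · exact hnd (X 3) (X 2) (X_ne_zero 2) he3
  · exact hnd (X 4) (X 3) (X_ne_zero 3) he4

/-- `(g)` is a prime ideal. [folklore] -/
theorem span_g_isPrime (k : Type) [Field k] (g : MvPolynomial (Fin 5) k)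
    (hg : g = X 2 ^ 2 + X 4 ^ 4 * X 1 ^ 2 * X 3 ^ 4 + (X 1 ^ 2 + X 0 ^ 3) ^ 3 + X 1 ^ 4 * X 3 ^ 2 + X 0 ^ 11 + X 3 ^ 7) :
    (Ideal.span {g}).IsPrime :=
  (Ideal.span_singleton_prime (prime_g k g hg).1.ne_zero).mpr (prime_g k g hg).1

/-- No variable lies in `(g)`. [folklore] -/
theorem g_X_ne_zero (k : Type) [Field k] (g : MvPolynomial (Fin 5) k)
    (hg : g = X 2 ^ 2 + X 4 ^ 4 * X 1 ^ 2 * X 3 ^ 4 + (X 1 ^ 2 + X 0 ^ 3) ^ 3 + X 1 ^ 4 * X 3 ^ 2 + X 0 ^ 11 + X 3 ^ 7)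
    (v : Fin 5) : Ideal.Quotient.mk (Ideal.span {g}) (MvPolynomial.X v) ≠ 0 := fun h0 =>
  (prime_g k g hg).2 v (Ideal.mem_span_singleton.mp (Ideal.Quotient.eq_zero_iff_mem.mp h0))

/-! ## Partial derivatives of `g` and of `g₀` -/

/-- `∂₀ g = 9X₀²(X₁² + X₀³)² + 11X₀¹⁰`. [folklore] -/
theorem pderiv_zero_g {A : Type*} [CommRing A] :
    pderiv 0 (X 2 ^ 2 + X 4 ^ 4 * X 1 ^ 2 * X 3 ^ 4 + (X 1 ^ 2 + X 0 ^ 3) ^ 3 + X 1 ^ 4 * X 3 ^ 2 + X 0 ^ 11 + X 3 ^ 7 :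
      MvPolynomial (Fin 5) A) =
      9 * X 0 ^ 2 * (X 1 ^ 2 + X 0 ^ 3) ^ 2 + 11 * X 0 ^ 10 := by
  simp only [map_add, Derivation.leibniz, pderiv_pow, pderiv_X_self, smul_eq_mul,
    pderiv_X_of_ne (show (1 : Fin 5) ≠ 0 by decide), pderiv_X_of_ne (show (2 : Fin 5) ≠ 0 by decide),
    pderiv_X_of_ne (show (3 : Fin 5) ≠ 0 by decide), pderiv_X_of_ne (show (4 : Fin 5) ≠ 0 by decide)]
  norm_num
  ring

/-- `∂₁ g = 2X₄⁴X₁X₃⁴ + 6X₁(X₁² + X₀³)² + 4X₁³X₃²`. [folklore] -/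
theorem pderiv_one_g {A : Type*} [CommRing A] :
    pderiv 1 (X 2 ^ 2 + X 4 ^ 4 * X 1 ^ 2 * X 3 ^ 4 + (X 1 ^ 2 + X 0 ^ 3) ^ 3 + X 1 ^ 4 * X 3 ^ 2 + X 0 ^ 11 + X 3 ^ 7 :
      MvPolynomial (Fin 5) A) =
      2 * X 4 ^ 4 * X 1 * X 3 ^ 4 + 6 * X 1 * (X 1 ^ 2 + X 0 ^ 3) ^ 2 + 4 * X 1 ^ 3 * X 3 ^ 2 := by
  simp only [map_add, Derivation.leibniz, pderiv_pow, pderiv_X_self, smul_eq_mul,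
    pderiv_X_of_ne (show (0 : Fin 5) ≠ 1 by decide), pderiv_X_of_ne (show (2 : Fin 5) ≠ 1 by decide),
    pderiv_X_of_ne (show (3 : Fin 5) ≠ 1 by decide), pderiv_X_of_ne (show (4 : Fin 5) ≠ 1 by decide)]
  norm_num
  ring

/-- `∂₂ g = 2X₂`. [folklore] -/
theorem pderiv_two_g {A : Type*} [CommRing A] :
    pderiv 2 (X 2 ^ 2 + X 4 ^ 4 * X 1 ^ 2 * X 3 ^ 4 + (X 1 ^ 2 + X 0 ^ 3) ^ 3 + X 1 ^ 4 * X 3 ^ 2 + X 0 ^ 11 + X 3 ^ 7 :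
      MvPolynomial (Fin 5) A) = 2 * X 2 := by
  simp only [map_add, Derivation.leibniz, pderiv_pow, pderiv_X_self, smul_eq_mul,
    pderiv_X_of_ne (show (0 : Fin 5) ≠ 2 by decide), pderiv_X_of_ne (show (1 : Fin 5) ≠ 2 by decide),
    pderiv_X_of_ne (show (3 : Fin 5) ≠ 2 by decide), pderiv_X_of_ne (show (4 : Fin 5) ≠ 2 by decide)]
  norm_num

/-- `∂₃ g = 4X₄⁴X₁²X₃³ + 2X₁⁴X₃ + 7X₃⁶`. [folklore] -/
theorem pderiv_three_g {A : Type*} [CommRing A] :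
    pderiv 3 (X 2 ^ 2 + X 4 ^ 4 * X 1 ^ 2 * X 3 ^ 4 + (X 1 ^ 2 + X 0 ^ 3) ^ 3 + X 1 ^ 4 * X 3 ^ 2 + X 0 ^ 11 + X 3 ^ 7 :
      MvPolynomial (Fin 5) A) = 4 * X 4 ^ 4 * X 1 ^ 2 * X 3 ^ 3 + 2 * X 1 ^ 4 * X 3 + 7 * X 3 ^ 6 := by
  simp only [map_add, Derivation.leibniz, pderiv_pow, pderiv_X_self, smul_eq_mul,
    pderiv_X_of_ne (show (0 : Fin 5) ≠ 3 by decide), pderiv_X_of_ne (show (1 : Fin 5) ≠ 3 by decide),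
    pderiv_X_of_ne (show (2 : Fin 5) ≠ 3 by decide), pderiv_X_of_ne (show (4 : Fin 5) ≠ 3 by decide)]
  norm_num
  ring

/-- `∂₄ g = 4X₄³X₁²X₃⁴`. [folklore] -/
theorem pderiv_four_g {A : Type*} [CommRing A] :
    pderiv 4 (X 2 ^ 2 + X 4 ^ 4 * X 1 ^ 2 * X 3 ^ 4 + (X 1 ^ 2 + X 0 ^ 3) ^ 3 + X 1 ^ 4 * X 3 ^ 2 + X 0 ^ 11 + X 3 ^ 7 :
      MvPolynomial (Fin 5) A) = 4 * X 4 ^ 3 * X 1 ^ 2 * X 3 ^ 4 := by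
  simp only [map_add, Derivation.leibniz, pderiv_pow, pderiv_X_self, smul_eq_mul,
    pderiv_X_of_ne (show (0 : Fin 5) ≠ 4 by decide), pderiv_X_of_ne (show (1 : Fin 5) ≠ 4 by decide),
    pderiv_X_of_ne (show (2 : Fin 5) ≠ 4 by decide), pderiv_X_of_ne (show (3 : Fin 5) ≠ 4 by decide)]
  norm_num
  ring

/-- `∂₀ g₀ = 9X₀²(X₁² + X₀³)²`. [folklore] -/
theorem pderiv_zero_g0 {A : Type*} [CommRing A] :
    pderiv 0 (X 2 ^ 2 + X 4 ^ 4 * X 1 ^ 2 * X 3 ^ 4 + (X 1 ^ 2 + X 0 ^ 3) ^ 3 + X 1 ^ 4 * X 3 ^ 2 : MvPolynomial (Fin 5) A) =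
      9 * X 0 ^ 2 * (X 1 ^ 2 + X 0 ^ 3) ^ 2 := by
  simp only [map_add, Derivation.leibniz, pderiv_pow, pderiv_X_self, smul_eq_mul,
    pderiv_X_of_ne (show (1 : Fin 5) ≠ 0 by decide), pderiv_X_of_ne (show (2 : Fin 5) ≠ 0 by decide),
    pderiv_X_of_ne (show (3 : Fin 5) ≠ 0 by decide), pderiv_X_of_ne (show (4 : Fin 5) ≠ 0 by decide)]
  norm_num
  ring

/-- `∂₁ g₀ = 2X₄⁴X₁X₃⁴ + 6X₁(X₁² + X₀³)² + 4X₁³X₃²`. [folklore] -/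
theorem pderiv_one_g0 {A : Type*} [CommRing A] :
    pderiv 1 (X 2 ^ 2 + X 4 ^ 4 * X 1 ^ 2 * X 3 ^ 4 + (X 1 ^ 2 + X 0 ^ 3) ^ 3 + X 1 ^ 4 * X 3 ^ 2 : MvPolynomial (Fin 5) A) =
      2 * X 4 ^ 4 * X 1 * X 3 ^ 4 + 6 * X 1 * (X 1 ^ 2 + X 0 ^ 3) ^ 2 + 4 * X 1 ^ 3 * X 3 ^ 2 := by
  simp only [map_add, Derivation.leibniz, pderiv_pow, pderiv_X_self, smul_eq_mul,
    pderiv_X_of_ne (show (0 : Fin 5) ≠ 1 by decide), pderiv_X_of_ne (show (2 : Fin 5) ≠ 1 by decide),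
    pderiv_X_of_ne (show (3 : Fin 5) ≠ 1 by decide), pderiv_X_of_ne (show (4 : Fin 5) ≠ 1 by decide)]
  norm_num
  ring

/-- `∂₂ g₀ = 2X₂`. [folklore] -/
theorem pderiv_two_g0 {A : Type*} [CommRing A] :
    pderiv 2 (X 2 ^ 2 + X 4 ^ 4 * X 1 ^ 2 * X 3 ^ 4 + (X 1 ^ 2 + X 0 ^ 3) ^ 3 + X 1 ^ 4 * X 3 ^ 2 : MvPolynomial (Fin 5) A) =
      2 * X 2 := by
  simp only [map_add, Derivation.leibniz, pderiv_pow, pderiv_X_self, smul_eq_mul,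
    pderiv_X_of_ne (show (0 : Fin 5) ≠ 2 by decide), pderiv_X_of_ne (show (1 : Fin 5) ≠ 2 by decide),
    pderiv_X_of_ne (show (3 : Fin 5) ≠ 2 by decide), pderiv_X_of_ne (show (4 : Fin 5) ≠ 2 by decide)]
  norm_num

/-- `∂₃ g₀ = 4X₄⁴X₁²X₃³ + 2X₁⁴X₃`. [folklore] -/
theorem pderiv_three_g0 {A : Type*} [CommRing A] :
    pderiv 3 (X 2 ^ 2 + X 4 ^ 4 * X 1 ^ 2 * X 3 ^ 4 + (X 1 ^ 2 + X 0 ^ 3) ^ 3 + X 1 ^ 4 * X 3 ^ 2 : MvPolynomial (Fin 5) A) =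
      4 * X 4 ^ 4 * X 1 ^ 2 * X 3 ^ 3 + 2 * X 1 ^ 4 * X 3 := by
  simp only [map_add, Derivation.leibniz, pderiv_pow, pderiv_X_self, smul_eq_mul,
    pderiv_X_of_ne (show (0 : Fin 5) ≠ 3 by decide), pderiv_X_of_ne (show (1 : Fin 5) ≠ 3 by decide),
    pderiv_X_of_ne (show (2 : Fin 5) ≠ 3 by decide), pderiv_X_of_ne (show (4 : Fin 5) ≠ 3 by decide)]
  norm_num
  ring

/-- `∂₄ g₀ = 4X₄³X₁²X₃⁴`. [folklore] -/
theorem pderiv_four_g0 {A : Type*} [CommRing A] :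
    pderiv 4 (X 2 ^ 2 + X 4 ^ 4 * X 1 ^ 2 * X 3 ^ 4 + (X 1 ^ 2 + X 0 ^ 3) ^ 3 + X 1 ^ 4 * X 3 ^ 2 : MvPolynomial (Fin 5) A) =
      4 * X 4 ^ 3 * X 1 ^ 2 * X 3 ^ 4 := by
  simp only [map_add, Derivation.leibniz, pderiv_pow, pderiv_X_self, smul_eq_mul,
    pderiv_X_of_ne (show (0 : Fin 5) ≠ 4 by decide), pderiv_X_of_ne (show (1 : Fin 5) ≠ 4 by decide),
    pderiv_X_of_ne (show (2 : Fin 5) ≠ 4 by decide), pderiv_X_of_ne (show (3 : Fin 5) ≠ 4 by decide)]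
  norm_num
  ring

/-! ## The graded coordinate change `σ : z ↦ z + 2t²yw²` -/

-- `exists_sigma` (the graded coordinate change `σ : z ↦ z + 2t²yw²`) is `RelGddF192Data.exists_sigma` (same σ).

/-- In characteristic `5`, `σ(F021) = g`: `(z + 2t²yw²)² + t²yw²(z + 2t²yw²) − z² − t⁴y²w⁴ = 5·(t²yw²z + t⁴y²w⁴)`. [folklore] -/
theorem sigma_f021_eq (k : Type) [Field k] [CharP k 5] (σ : MvPolynomial (Fin 5) k ≃ₐ[k] MvPolynomial (Fin 5) k)
    (h0 : σ (X 0) = X 0) (h1 : σ (X 1) = X 1) (h2 : σ (X 2) = X 2 + 2 * X 4 ^ 2 * X 1 * X 3 ^ 2) (h3 : σ (X 3) = X 3)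
    (h4 : σ (X 4) = X 4) :
    σ (X 2 ^ 2 + (X 1 ^ 2 + X 0 ^ 3) ^ 3 + X 0 ^ 11 + X 3 ^ 7 + X 4 ^ 2 * X 1 * X 2 * X 3 ^ 2 + X 1 ^ 4 * X 3 ^ 2) =
      X 2 ^ 2 + X 4 ^ 4 * X 1 ^ 2 * X 3 ^ 4 + (X 1 ^ 2 + X 0 ^ 3) ^ 3 + X 1 ^ 4 * X 3 ^ 2 + X 0 ^ 11 + X 3 ^ 7 := by
  have h5 : (5 : MvPolynomial (Fin 5) k) = 0 := by exact_mod_cast CharP.cast_eq_zero (MvPolynomial (Fin 5) k) 5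
  simp only [map_add, map_mul, map_pow, h0, h1, h2, h3, h4]
  linear_combination (X 4 ^ 2 * X 1 * X 3 ^ 2 * X 2 + X 4 ^ 4 * X 1 ^ 2 * X 3 ^ 4) * h5

end Summit.ResolutionOfSingularities.ResolutionOfSingularities.Theorems.FInjectiveMacaulayfication.RelGddF021Data

end
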